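import Summits.QuantumFields.QCD.Theorems.QuarksAsStableActionStableActionBridgeStubPermExact
import Literature.MathematicalPhysics.QuantumFieldTheory.QCDTimeReflectionProofs
import HarnessLib

/-!
# Exact permutation symmetry (OS E3) of the thermal, Θ-symmetrised lattice `n`-point distributions

Stub `stub_permExactSymAP` of the line `Sketch` (reshape r3e) for the crux `QuarksAsStableAction.StableActionBridge`
(stmt-QuantumFields-9737): for every scheme, step `k`, arity `n`, species string `σ`, permutation `π` and test
function `F`,
  `qcdLatticeDistSymAP sch k n σ (permTest π F) = qcdLatticeDistSymAP sch k n (σ ∘ π) F`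
EXACTLY at finite `k`, for the THERMAL functional (`qcdTorusExpectAP`, antiperiodic quarks) with Θ-SYMMETRISED
insertions `insertionSym U s y = ½ (insertion U s y + Θ (insertion (Θ'U) s (θy)))`.

Proof.  Same argument as the periodic twin `stub_permExact`
(`QuarksAsStableActionStableActionBridgeStubPermExact.lean`), with one new ingredient: the site reflection `Θ`
(`torusTheta`) maps CENTRAL Grassmann elements to central ones — it is an order-reversing involution
(`torusTheta_mul`, `torusTheta_torusTheta`), so for central `a` and any `b`,
`Θa · b = Θa · Θ(Θb) = Θ(Θb · a) = Θ(a · Θb) = Θ(Θb) · Θa = b · Θa`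
(`commute_torusTheta_of_forall_commute`).  Hence the symmetrised insertions (`commute_insertionSym`) and their
renormalised centred versions (`commute_renormInsertionSym`) are central, the ORDERED product
`∏ᵢ renormInsertionSym (σ i) (x i) U` is invariant under reindexing by `π` (`prod_ofFn_comp_perm_of_commute`), so
the thermal weights satisfy `W^{AP,sym}_{σ∘π}(x ∘ π) = W^{AP,sym}_σ(x)` (`qcdTorusMomentSymAP_comp_perm`;
`qcdTorusExpectAP` is a function of the observable), and reindexing the finite sum `qcdLatticeDistSymAP_apply`
over `(box L_k)ⁿ` by `x ↦ x ∘ π` gives the claim (`permTest_apply`); in degree `0` both sides are point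
evaluation at the unique point.
Everything is proved; no named fact.  References: Osterwalder–Schrader 1973 §2 (E3); Osterwalder–Seiler 1978 §2;
Montvay–Münster 1994 §4.1.3 (4.34), §4.2.3 (4.99).
-/

noncomputable section

open scoped SchwartzMap BigOperators
open MeasureTheory
open Literature.MathematicalPhysics.QuantumFieldTheory Literature.MathematicalPhysics.QuantumLattice
open Literature.MathematicalPhysics.AQFT
open Literature.Probability.LatticeModels (box Site TorusSite)

local notation "E4" => EuclideanSpace ℝ (Fin 4)

namespace Summit.QuantumFields.QCD.Cruxes.StableActionBridge.Sketch

/-! ### The site reflection preserves centrality -/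

section Central

variable {Nf L : ℕ} [NeZero L]

/-- The site reflection `Θ` (`torusTheta`) of a CENTRAL Grassmann element is central: `Θ` is an order-reversing
involution, so `Θa · b = Θ(Θb · a) = Θ(a · Θb) = b · Θa`. -/
theorem commute_torusTheta_of_forall_commute {a : FermiAlg Nf L} (ha : ∀ c, Commute a c)
    (b : FermiAlg Nf L) : Commute (torusTheta a) b := by
  have h := congrArg torusTheta (ha (torusTheta b)).eq
  simp only [torusTheta_mul, torusTheta_torusTheta] at h
  exact h.symm

/-- The Θ-symmetrised lattice insertion of every species at every site is central in the Grassmann algebra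
(the insertion is, `commute_insertion`, and `Θ` preserves centrality). -/
theorem commute_insertionSym (U : GaugeConfig 4 L (Matrix.specialUnitaryGroup (Fin 3) ℂ)) (s : QCDField Nf)
    (y : Site 4) (z : FermiAlg Nf L) : Commute (insertionSym U s y) z := by
  unfold insertionSym
  exact ((commute_insertion U s y z).add_left
    (commute_torusTheta_of_forall_commute (fun c => commute_insertion U.negReflect s (siteReflect y) c) z)).smul_left _

end Central

variable {Nf : ℕ}

/-- The renormalised, centred, Θ-symmetrised insertion `z_s(k) a_k⁴ (O^sym_s(y) − shift_s(k))` is central in the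
Grassmann algebra. -/
theorem commute_renormInsertionSym (sch : QCDScheme Nf) (k : ℕ) (s : QCDField Nf) (y : Site 4)
    (U : GaugeConfig 4 (sch.side k) (Matrix.specialUnitaryGroup (Fin 3) ℂ)) (z : FermiAlg Nf (sch.side k)) :
    Commute (renormInsertionSym sch k s y U) z := by
  unfold renormInsertionSym
  exact ((commute_insertionSym U s y z).sub_left (Algebra.commute_algebraMap_left _ _)).smul_left _

/-! ### Permutation symmetry of the thermal weights and of the distribution -/

-- adapted from `qcdTorusMomentStr_comp_perm` / `stub_permExact` in
-- `Summits/QuantumFields/QCD/Theorems/QuarksAsStableActionStableActionBridgeStubPermExact.lean`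
-- (periodic functional there; here the thermal functional is a plain function of the observable).

/-- **Permutation symmetry of the thermal weights**: permuting the species string and the sites simultaneously
does not change the thermal torus moment, `W^{AP,sym}_{σ∘π}(x ∘ π) = W^{AP,sym}_σ(x)` — the ordered product of
the (central) renormalised symmetrised insertions is reindexed by `π`. -/
theorem qcdTorusMomentSymAP_comp_perm (sch : QCDScheme Nf) (k : ℕ) {n : ℕ} (σ : Fin n → QCDField Nf)
    (x : Fin n → Site 4) (π : Equiv.Perm (Fin n)) :
    qcdTorusMomentSymAP sch k (σ ∘ π) (x ∘ π) = qcdTorusMomentSymAP sch k σ x := by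
  unfold qcdTorusMomentSymAP
  congr 1
  funext U
  exact prod_ofFn_comp_perm_of_commute (fun i => renormInsertionSym sch k (σ i) (x i) U)
    (fun i z => commute_renormInsertionSym sch k (σ i) (x i) U z) π

/-- **Stub `stub_permExactSymAP` (OS E3 on the lattice, exactly, for the thermal Θ-symmetrised distributions).**
For every scheme, step `k`, arity `n`, species string `σ`, permutation `π` and test function `F`:
`qcdLatticeDistSymAP sch k n σ (permTest π F) = qcdLatticeDistSymAP sch k n (σ ∘ π) F` — the species string
travels with its argument, as in `LabelledSchwingerFamily.IsSymmetric`.  Degree `0`: both sides are evaluation at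
the unique point; degree `n ≥ 1`: reindex the finite sum `qcdLatticeDistSymAP_apply` by `x ↦ x ∘ π` and use
`qcdTorusMomentSymAP_comp_perm`, `permTest_apply`. -/
theorem stub_permExactSymAP : ∀ {Nf : ℕ} (sch : QCDScheme Nf) (k n : ℕ) (σ : Fin n → QCDField Nf)
    (π : Equiv.Perm (Fin n)) (F : 𝓢((Fin n → E4), ℂ)),
    qcdLatticeDistSymAP sch k n σ (permTest π F) = qcdLatticeDistSymAP sch k n (σ ∘ π) F := by
  intro Nf sch k n σ π F
  rcases Nat.eq_zero_or_pos n with rfl | hn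
  · rw [qcdLatticeDistSymAP_zero_apply, qcdLatticeDistSymAP_zero_apply, permTest_apply]
    exact congrArg F (Subsingleton.elim _ _)
  · rw [qcdLatticeDistSymAP_apply sch k hn.ne', qcdLatticeDistSymAP_apply sch k hn.ne']
    -- reindex the sum over multi-sites by `x ↦ x ∘ π`
    refine Finset.sum_bij' (fun x _ => x ∘ π) (fun x _ => x ∘ π.symm) (fun x hx => ?_)
      (fun x hx => ?_) (fun x _ => ?_) (fun x _ => ?_) (fun x _ => ?_)
    · simp only [Fintype.mem_piFinset, Function.comp_apply] at hx ⊢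
      exact fun i => hx _
    · simp only [Fintype.mem_piFinset, Function.comp_apply] at hx ⊢
      exact fun i => hx _
    · funext i; simp
    · funext i; simp
    · rw [qcdTorusMomentSymAP_comp_perm, permTest_apply]
      rfl

end Summit.QuantumFields.QCD.Cruxes.StableActionBridge.Sketch

end
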